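import Literature.Analysis.FluidPDE.PerturbedNSFourierDefs
import Literature.Analysis.FluidPDE.PerturbedNSFourierEstimates
import HarnessLib

/-!
# Picard iteration for the Fourier-transformed perturbed Navier–Stokes system: the Duhamel map

Analysis/FluidPDE proof file, sequel of `PerturbedNSFourierDefs` (objects),
`PerturbedNSFourierLattice` and `PerturbedNSFourierEstimates` (order-four lattice toolkit), in
the chain `PerturbedNSFourier*` proving short-time existence of smooth solutions of the
perturbed Navier–Stokes system `∂ₜv + (v·∇)v + (u·∇)v + (v·∇)u + ∇q = νΔv`, `div v = 0`,
`v(0) = v₀` around a smooth divergence-free background on `T^d`, `#d ≤ 3`, with a life span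
controlled by the fourth Sobolev sums of the datum (Majda–Bertozzi 2002, Thm. 3.4;
Cheskidov–Luo 2022, §3.1 (3.2) for the system). The mild form

  `c(l,t,k) = e^{-νₖτ} a(l,k) - ∫₀^τ e^{-νₖ(τ-s)} (P G)(U(s), 0, c(s))(l,k) ds`, `τ = clamp θ t`,

is iterated in the ball `{sup_{l,t} (1+‖k‖)⁴ ‖c(l,t,k)‖ ≤ ρ}` of the ORDER-FOUR weighted
sup-norm. This file provides the ingredients of the contraction argument under the threshold
hypotheses `BallHyp ν θ U a Z ρ A` (the datum in the ball of radius `ρ/2`,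
`gainConst ν √θ · ballConst ≤ ρ/2`, `gainConst ν √θ · lipConst ≤ 1/2`):

* `norm_duhamel_gain` — **heat gain on short intervals at viscosity `ν`**:
  `(1+‖k‖) ‖∫₀^τ e^{-νₖ(τ-s)} F‖ ≤ gainConst ν · √θ · sup ‖F‖` for `τ ≤ θ ≤ 1`
  (`ScalarFourier.heat_weight_gain` with the weight `λ = 1/θ`);
* `BallHyp.hasDecay_picardMap` — the Duhamel map sends the order-four ball of radius `ρ` to
  itself (the projected symbol loses one derivative with constant `ballConst`,
  `hasDecay_convSym_four`, the heat factor regains it); `BallHyp.continuous_picardMap`;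
* `BallHyp.hasDecay_picardMap_sub` — the map contracts order-four differences by `1/2`
  (`hasDecay_convSym_sub_four`, constant `lipConst`);
* `exists_threshold` — for every radius `ρ > 0`, mass `Z`, drift constant `A` and viscosity there
  is `θ₀ ∈ (0, 1]` below which both threshold inequalities hold ("for all sufficiently small
  `τ`", Cheskidov–Luo 2022, §3.1, quantified).

The iteration itself (convergence, the limit, the fixed point, the datum) is in
`PerturbedNSFourierIteration`.

## References

* A. J. Majda, A. L. Bertozzi, *Vorticity and Incompressible Flow*, CUP 2002, Thm. 3.4. [`MajdaBertozziCUP2002`]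
* A. Cheskidov, X. Luo, arXiv:2009.06596, §3.1 (3.2), Prop. 3.2. [`CheskidovLuo2022`]
* P. G. Lemarié-Rieusset, *The Navier–Stokes problem in the 21st century*, CRC 2016, §8.5.
* J. Leray, Acta Math. 63 (1934), §19 (successive approximations). [`Leray1934`]
-/

noncomputable section

open MeasureTheory Real Set Filter Topology UnitAddTorus

namespace Literature.Analysis.FluidPDE

namespace PerturbedNSFourier

open ScalarFourier
open CorrectorFourier (leraySym projSym projSym_apply hasDecay_projSym_of_convSym hasDecay_projSym_sub)
open FourierNS (HasDecay clamp)
open Literature.Analysis.FunctionSpaces.Torus (freqNormSq)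

variable {d : Type*} [Fintype d] [DecidableEq d]
variable {ν θ : ℝ} {U : d → ℝ → (d → ℤ) → ℂ} {a : d → (d → ℤ) → ℂ} {Z ρ A : ℝ}

/-! ### The constants -/

section Constants

omit [DecidableEq d] in
/-- `gainConst ν > 0`. [folklore] -/
theorem gainConst_pos (ν : ℝ) : 0 < gainConst ν := by
  rw [gainConst_def]; positivity

omit [DecidableEq d] in
/-- `ballConst ≥ 0` for nonnegative parameters. [folklore] -/
theorem ballConst_nonneg (hZ : 0 ≤ Z) (hρ : 0 ≤ ρ) (hA : 0 ≤ A) : 0 ≤ ballConst d Z ρ A := by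
  rw [ballConst_def]; positivity

omit [DecidableEq d] in
/-- `lipConst ≥ 0` for nonnegative parameters. [folklore] -/
theorem lipConst_nonneg (hZ : 0 ≤ Z) (hρ : 0 ≤ ρ) (hA : 0 ≤ A) : 0 ≤ lipConst d Z ρ A := by
  rw [lipConst_def]; positivity

end Constants

/-! ### The Duhamel integral regains one derivative at the price `gainConst ν · √θ` -/

section Gain

omit [DecidableEq d] in
/-- **Heat gain on short intervals at viscosity `ν`.** For `ν > 0`, `0 < θ ≤ 1`, `τ ∈ [0, θ]`
and an integrand bounded by `M` on `[0, τ]`: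
`(1 + ‖k‖) ‖∫₀^τ e^{-νₖ(τ-s)} F(s) ds‖ ≤ M · gainConst ν · √θ`
(`ScalarFourier.heat_weight_gain` with the weight `λ = 1/θ`, for which `e^{λτ} ≤ e` and
`1/√λ = √θ`; adapted from `CorrectorFourier.norm_duhamel_gain`, viscosity one). [folklore] -/
theorem norm_duhamel_gain [DecidableEq d] (hν : 0 < ν) (hθ : 0 < θ) (hθ1 : θ ≤ 1) {τ : ℝ}
    (hτ : τ ∈ Icc 0 θ) {F : ℝ → ℂ} {M : ℝ} (hM : 0 ≤ M) (hbound : ∀ s ∈ Icc 0 τ, ‖F s‖ ≤ M)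
    (k : d → ℤ) :
    (1 + ‖k‖) * ‖∫ s in (0 : ℝ)..τ, (heatFactor ν k (τ - s) : ℂ) * F s‖ ≤
      M * (gainConst ν * Real.sqrt θ) := by
  set lam : ℝ := 1 / θ with hlam
  have hlam1 : 1 ≤ lam := by rw [hlam, le_div_iff₀ hθ, one_mul]; exact hθ1
  have hb : ∀ s ∈ Icc 0 τ, ‖F s‖ ≤ M * Real.exp (lam * s) := fun s hs =>
    (hbound s hs).trans (le_mul_of_one_le_right hM (Real.one_le_exp (by
      have : 0 ≤ lam := by linarith
      exact mul_nonneg this hs.1)))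
  have h1 := norm_duhamel_le ν hτ.1 hb k
  have h2 := heat_weight_gain (d := d) hν hlam1 k hτ.1
  have hexp : Real.exp (lam * τ) ≤ Real.exp 1 := by
    refine Real.exp_le_exp.2 ?_
    rw [hlam, one_div, inv_mul_le_iff₀ hθ, mul_one]
    exact hτ.2
  have hsq : Real.sqrt lam = 1 / Real.sqrt θ := by
    rw [hlam, Real.sqrt_div' _ hθ.le, Real.sqrt_one]
  have hsθ : 0 < Real.sqrt θ := Real.sqrt_pos.2 hθ
  have hE : 0 ≤ 1 + 1 / (2 * Real.sqrt (4 * π ^ 2 * ν)) := by positivity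
  have hI : 0 ≤ ∫ s in (0 : ℝ)..τ, Real.exp (-(heatRate ν k) * (τ - s)) * Real.exp (lam * s) :=
    intervalIntegral.integral_nonneg hτ.1 fun s _ => by positivity
  calc (1 + ‖k‖) * ‖∫ s in (0 : ℝ)..τ, (heatFactor ν k (τ - s) : ℂ) * F s‖
      ≤ (1 + ‖k‖) * (M * ∫ s in (0 : ℝ)..τ, Real.exp (-(heatRate ν k) * (τ - s)) * Real.exp (lam * s)) :=
        mul_le_mul_of_nonneg_left h1 (by positivity)
    _ = M * ((1 + ‖k‖) * ∫ s in (0 : ℝ)..τ, Real.exp (-(heatRate ν k) * (τ - s)) * Real.exp (lam * s)) := by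
        ring
    _ ≤ M * (Real.exp (lam * τ) * ((1 + 1 / (2 * Real.sqrt (4 * π ^ 2 * ν))) / Real.sqrt lam)) :=
        mul_le_mul_of_nonneg_left h2 hM
    _ ≤ M * (Real.exp 1 * ((1 + 1 / (2 * Real.sqrt (4 * π ^ 2 * ν))) / Real.sqrt lam)) := by
        gcongr
    _ = M * (gainConst ν * Real.sqrt θ) := by
        rw [hsq, gainConst_def]
        field_simp

end Gain

/-! ### The Duhamel map on the order-four ball -/

section Ball

/-- **The projected symbol of a field in the ball**: if `c` decays to order four with constant
`ρ` uniformly in `(l, t)`, then `P convSym(U(s), 0, c(s))` decays to order three with the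
constant `ballConst` (`hasDecay_convSym_four` at zero stress and the projector factor
`2#d`). [folklore] -/
theorem BallHyp.hasDecay_projSym (h : BallHyp ν θ U a Z ρ A) {c : d → ℝ → (d → ℤ) → ℂ}
    (hc : ∀ l t, HasDecay 4 ρ (c l t)) (l : d) (s : ℝ) :
    HasDecay 3 (ballConst d Z ρ A) (projSym (fun j => U j s) 0 (fun j => c j s) l) := by
  have hR : ∀ i j : d, HasDecay (3 + 1) 0 ((0 : d → d → (d → ℤ) → ℂ) i j) := fun i j m => by
    simp only [Pi.zero_apply, norm_zero, zero_mul, le_refl]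
  have hconv := fun m => hasDecay_convSym_four (K := 3) (RH := (0 : d → d → (d → ℤ) → ℂ)) h.hZ
    h.hA h.hρ (fun j => h.hU4 j s) (fun j => h.hU4 j s) (fun j => hc j s) (fun j => hc j s) hR m
  have hproj := hasDecay_projSym_of_convSym hconv l
  refine hproj.mono (le_of_eq ?_)
  rw [ballConst_def]
  ring

/-- **The Duhamel map sends the order-four ball of radius `ρ` to itself**: the datum term is
bounded by `ρ/2` (the heat factor is at most one) and the Duhamel term by
`gainConst ν √θ · ballConst ≤ ρ/2` (`norm_duhamel_gain`, `BallHyp.hS1`). [folklore] -/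
theorem BallHyp.hasDecay_picardMap (h : BallHyp ν θ U a Z ρ A) {c : d → ℝ → (d → ℤ) → ℂ}
    (hc : ∀ l t, HasDecay 4 ρ (c l t)) (l : d) (t : ℝ) :
    HasDecay 4 ρ (picardMap ν θ U a c l t) := by
  intro k
  have hτ := FourierNS.clamp_mem_Icc h.hθ.le t
  set τ := clamp θ t with hτdef
  have hN : ∀ s, HasDecay 3 (ballConst d Z ρ A) (projSym (fun j => U j s) 0 (fun j => c j s) l) :=
    fun s => h.hasDecay_projSym hc l s
  have hB0 : 0 ≤ ballConst d Z ρ A := ballConst_nonneg (weight_four_mass_nonneg h.hZ) h.hρ h.hA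
  have hM : 0 ≤ ballConst d Z ρ A * ((1 + ‖k‖) ^ 3)⁻¹ := by positivity
  have hgain := norm_duhamel_gain h.hν h.hθ h.hθ1 hτ hM (fun s _ => hN s k)
    (F := fun s => projSym (fun j => U j s) 0 (fun j => c j s) l k) k
  have hw : (0 : ℝ) < 1 + ‖k‖ := by positivity
  have hw4 : (0 : ℝ) ≤ ((1 + ‖k‖) ^ 4)⁻¹ := by positivity
  have hpow : ((1 + ‖k‖) ^ 4)⁻¹ = ((1 + ‖k‖) ^ 3)⁻¹ * (1 + ‖k‖)⁻¹ := by
    rw [pow_succ, mul_inv]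
  -- the datum term
  have hheat : ‖(heatFactor ν k τ : ℂ) * a l k‖ ≤ ρ / 2 * ((1 + ‖k‖) ^ 4)⁻¹ := by
    rw [norm_mul, norm_heatFactor]
    calc heatFactor ν k τ * ‖a l k‖ ≤ 1 * ‖a l k‖ :=
          mul_le_mul_of_nonneg_right (heatFactor_le_one h.hν.le k hτ.1) (norm_nonneg _)
      _ ≤ ρ / 2 * ((1 + ‖k‖) ^ 4)⁻¹ := by rw [one_mul]; exact h.ha4 l k
  -- the Duhamel term
  have hduh : ‖∫ s in (0 : ℝ)..τ, (heatFactor ν k (τ - s) : ℂ) *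
      projSym (fun j => U j s) 0 (fun j => c j s) l k‖ ≤
      gainConst ν * Real.sqrt θ * ballConst d Z ρ A * ((1 + ‖k‖) ^ 4)⁻¹ := by
    rw [hpow]
    have key : ‖∫ s in (0 : ℝ)..τ, (heatFactor ν k (τ - s) : ℂ) *
        projSym (fun j => U j s) 0 (fun j => c j s) l k‖ ≤
        ballConst d Z ρ A * ((1 + ‖k‖) ^ 3)⁻¹ * (gainConst ν * Real.sqrt θ) * (1 + ‖k‖)⁻¹ := by
      rw [le_mul_inv_iff₀ hw, mul_comm]
      exact hgain
    refine key.trans (le_of_eq ?_)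
    ring
  rw [picardMap, ← hτdef]
  calc ‖(heatFactor ν k τ : ℂ) * a l k - ∫ s in (0 : ℝ)..τ, (heatFactor ν k (τ - s) : ℂ) *
        projSym (fun j => U j s) 0 (fun j => c j s) l k‖
      ≤ ‖(heatFactor ν k τ : ℂ) * a l k‖ + ‖∫ s in (0 : ℝ)..τ, (heatFactor ν k (τ - s) : ℂ) *
        projSym (fun j => U j s) 0 (fun j => c j s) l k‖ := norm_sub_le _ _
    _ ≤ ρ / 2 * ((1 + ‖k‖) ^ 4)⁻¹ + gainConst ν * Real.sqrt θ * ballConst d Z ρ A * ((1 + ‖k‖) ^ 4)⁻¹ :=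
        add_le_add hheat hduh
    _ ≤ ρ / 2 * ((1 + ‖k‖) ^ 4)⁻¹ + ρ / 2 * ((1 + ‖k‖) ^ 4)⁻¹ :=
        add_le_add le_rfl (mul_le_mul_of_nonneg_right h.hS1 hw4)
    _ = ρ * ((1 + ‖k‖) ^ 4)⁻¹ := by ring

/-- The projected symbol of a continuous, uniformly order-four decaying field along the drift
data is continuous in time at each component and frequency. [folklore] -/
theorem BallHyp.continuous_projSym (h : BallHyp ν θ U a Z ρ A) {c : d → ℝ → (d → ℤ) → ℂ} {X : ℝ}
    (hcc : ∀ l m, Continuous fun t => c l t m) (hc : ∀ l t, HasDecay 4 X (c l t)) (l : d) (k : d → ℤ) :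
    Continuous fun s => projSym (fun j => U j s) 0 (fun j => c j s) l k :=
  continuous_projSym_param_four h.hZ (Y := ℝ) (U := fun s j => U j s)
    (RH := fun _ => (0 : d → d → (d → ℤ) → ℂ)) (c := fun s j => c j s)
    (fun j m => h.contU j m) (fun _ _ _ => continuous_const) hcc (fun s j => h.hU4 j s)
    (fun s j => hc j s) l k

/-- The Duhamel integrand `s ↦ e^{-νₖ(τ-s)} (P G)(U(s), 0, c(s))(l, k)` is continuous. [folklore] -/
theorem BallHyp.continuous_integrand (h : BallHyp ν θ U a Z ρ A) {c : d → ℝ → (d → ℤ) → ℂ} {X : ℝ}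
    (hcc : ∀ l m, Continuous fun t => c l t m) (hc : ∀ l t, HasDecay 4 X (c l t)) (l : d) (k : d → ℤ)
    (τ : ℝ) : Continuous fun s => (heatFactor ν k (τ - s) : ℂ) *
      projSym (fun j => U j s) 0 (fun j => c j s) l k :=
  (continuous_heatFactor_comp (continuous_const.sub continuous_id) ν k).mul (h.continuous_projSym hcc hc l k)

/-- **Continuity of the Duhamel map in time**: `t ↦ Φ(c)(l, t, k)` is continuous when `c` is
continuous in time with uniform order-four decay (parametric interval integrals, Mathlib
`intervalIntegral.continuous_parametric_intervalIntegral_of_continuous`). [folklore] -/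
theorem BallHyp.continuous_picardMap (h : BallHyp ν θ U a Z ρ A) {c : d → ℝ → (d → ℤ) → ℂ} {X : ℝ}
    (hcc : ∀ l m, Continuous fun t => c l t m) (hc : ∀ l t, HasDecay 4 X (c l t)) (l : d) (k : d → ℤ) :
    Continuous fun t => picardMap ν θ U a c l t k := by
  have h1 : Continuous fun t => (heatFactor ν k (clamp θ t) : ℂ) * a l k :=
    (continuous_heatFactor_comp (FourierNS.continuous_clamp θ) ν k).mul continuous_const
  have hF : Continuous (Function.uncurry fun (t s : ℝ) => (heatFactor ν k (clamp θ t - s) : ℂ) *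
      projSym (fun j => U j s) 0 (fun j => c j s) l k) := by
    have hcl : Continuous fun p : ℝ × ℝ => clamp θ p.1 - p.2 :=
      ((FourierNS.continuous_clamp θ).comp continuous_fst).sub continuous_snd
    exact (continuous_heatFactor_comp hcl ν k).mul ((h.continuous_projSym hcc hc l k).comp continuous_snd)
  have h2 := intervalIntegral.continuous_parametric_intervalIntegral_of_continuous (μ := volume)
    (a₀ := 0) hF (FourierNS.continuous_clamp θ)
  exact h1.sub h2

/-- **Lipschitz bound for the projected symbol on the ball**: for `c`, `c'` in the order-four
ball of radius `ρ` with difference of order-four constant `D`, the difference of the projected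
symbols decays to order three with constant `lipConst · D` (`hasDecay_convSym_sub_four`). [folklore] -/
theorem BallHyp.hasDecay_projSym_sub (h : BallHyp ν θ U a Z ρ A) {c c' : d → ℝ → (d → ℤ) → ℂ}
    (hc : ∀ l t, HasDecay 4 ρ (c l t)) (hc' : ∀ l t, HasDecay 4 ρ (c' l t)) {D : ℝ} (hD : 0 ≤ D)
    (hdiff : ∀ l t, HasDecay 4 D (fun m => c l t m - c' l t m)) (l : d) (s : ℝ) :
    HasDecay 3 (lipConst d Z ρ A * D)
      (fun k => projSym (fun j => U j s) 0 (fun j => c j s) l k -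
        projSym (fun j => U j s) 0 (fun j => c' j s) l k) := by
  have hconv := fun m => hasDecay_convSym_sub_four (K := 3) (RH := (0 : d → d → (d → ℤ) → ℂ)) h.hZ
    h.hA h.hρ h.hρ hD (fun j => h.hU4 j s) (fun j => h.hU4 j s) (fun j => hc j s) (fun j => hc j s)
    (fun j => hc' j s) (fun j => hc' j s) (fun j => hdiff j s) (fun j => hdiff j s) m
  have hproj := CorrectorFourier.hasDecay_projSym_sub hconv l
  refine hproj.mono (le_of_eq ?_)
  rw [lipConst_def]
  ring

/-- **The Duhamel map contracts order-four differences by `1/2`.** For `c`, `c'` continuous in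
time, in the order-four ball of radius `ρ`, with difference of order-four constant `D`,
`Φ(c) - Φ(c')` has order-four constant `½ D`: the difference of the Duhamel integrals is the
Duhamel integral of the difference of the projected symbols (`hasDecay_projSym_sub`,
constant `lipConst · D` at order three), and the heat factor regains the derivative at the
price `gainConst ν √θ` (`norm_duhamel_gain`); `gainConst ν √θ · lipConst ≤ 1/2`
(`BallHyp.hS2`). [folklore] -/
theorem BallHyp.hasDecay_picardMap_sub (h : BallHyp ν θ U a Z ρ A) {c c' : d → ℝ → (d → ℤ) → ℂ}
    (hcc : ∀ l m, Continuous fun t => c l t m) (hcc' : ∀ l m, Continuous fun t => c' l t m)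
    (hc : ∀ l t, HasDecay 4 ρ (c l t)) (hc' : ∀ l t, HasDecay 4 ρ (c' l t)) {D : ℝ} (hD : 0 ≤ D)
    (hdiff : ∀ l t, HasDecay 4 D (fun m => c l t m - c' l t m)) (l : d) (t : ℝ) :
    HasDecay 4 (1 / 2 * D) (fun m => picardMap ν θ U a c l t m - picardMap ν θ U a c' l t m) := by
  intro k
  have hτ := FourierNS.clamp_mem_Icc h.hθ.le t
  set τ := clamp θ t with hτdef
  have hN : ∀ s, HasDecay 3 (lipConst d Z ρ A * D)
      (fun m => projSym (fun j => U j s) 0 (fun j => c j s) l m -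
        projSym (fun j => U j s) 0 (fun j => c' j s) l m) := fun s =>
    h.hasDecay_projSym_sub hc hc' hD hdiff l s
  have hL0 : 0 ≤ lipConst d Z ρ A := lipConst_nonneg (weight_four_mass_nonneg h.hZ) h.hρ h.hA
  have hM : 0 ≤ lipConst d Z ρ A * D * ((1 + ‖k‖) ^ 3)⁻¹ := by positivity
  -- the difference of the Duhamel maps is the Duhamel integral of the difference
  set F : ℝ → ℂ := fun s => projSym (fun j => U j s) 0 (fun j => c j s) l k with hF
  set F' : ℝ → ℂ := fun s => projSym (fun j => U j s) 0 (fun j => c' j s) l k with hF'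
  have hi := (h.continuous_integrand hcc hc l k τ).intervalIntegrable (μ := volume) 0 τ
  have hi' := (h.continuous_integrand hcc' hc' l k τ).intervalIntegrable (μ := volume) 0 τ
  have hint : picardMap ν θ U a c l t k - picardMap ν θ U a c' l t k =
      -∫ s in (0 : ℝ)..τ, (heatFactor ν k (τ - s) : ℂ) * (F s - F' s) := by
    simp only [picardMap, ← hτdef]
    rw [sub_sub_sub_cancel_left, ← intervalIntegral.integral_sub hi' hi, ← intervalIntegral.integral_neg]
    refine intervalIntegral.integral_congr fun s _ => ?_
    simp only [hF, hF']
    ring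
  have hgain := norm_duhamel_gain h.hν h.hθ h.hθ1 hτ hM (fun s _ => hN s k) (F := fun s => F s - F' s) k
  have hw : (0 : ℝ) < 1 + ‖k‖ := by positivity
  have hpow : ((1 + ‖k‖) ^ 4)⁻¹ = ((1 + ‖k‖) ^ 3)⁻¹ * (1 + ‖k‖)⁻¹ := by
    rw [pow_succ, mul_inv]
  change ‖picardMap ν θ U a c l t k - picardMap ν θ U a c' l t k‖ ≤ _
  rw [hint, norm_neg, hpow]
  have key : ‖∫ s in (0 : ℝ)..τ, (heatFactor ν k (τ - s) : ℂ) * (F s - F' s)‖ ≤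
      lipConst d Z ρ A * D * ((1 + ‖k‖) ^ 3)⁻¹ * (gainConst ν * Real.sqrt θ) * (1 + ‖k‖)⁻¹ := by
    rw [le_mul_inv_iff₀ hw, mul_comm]
    exact hgain
  refine key.trans ?_
  have hw3 : (0 : ℝ) ≤ ((1 + ‖k‖) ^ 3)⁻¹ * (1 + ‖k‖)⁻¹ := by positivity
  calc lipConst d Z ρ A * D * ((1 + ‖k‖) ^ 3)⁻¹ * (gainConst ν * Real.sqrt θ) * (1 + ‖k‖)⁻¹
      = (gainConst ν * Real.sqrt θ * lipConst d Z ρ A) * D * (((1 + ‖k‖) ^ 3)⁻¹ * (1 + ‖k‖)⁻¹) := by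
        ring
    _ ≤ 1 / 2 * D * (((1 + ‖k‖) ^ 3)⁻¹ * (1 + ‖k‖)⁻¹) :=
        mul_le_mul_of_nonneg_right (mul_le_mul_of_nonneg_right h.hS2 hD) hw3

end Ball

/-! ### The threshold on the interval length -/

section Threshold

omit [DecidableEq d] in
/-- **The threshold on the interval length.** For every radius `ρ > 0`, lattice mass `Z ≥ 0`,
drift constant `A ≥ 0` and viscosity there is `θ₀ ∈ (0, 1]` such that for all `0 < θ ≤ θ₀`:
`gainConst ν √θ · ballConst ≤ ρ/2` and `gainConst ν √θ · lipConst ≤ 1/2` (elementary: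
`√θ ≤ 1/(M+1)` for `M = max (2 gain·ballConst/ρ) (2 gain·lipConst)`). This is the life span
of the short-time theory in terms of the size `ρ` of the datum ball and the background
constant `A` (Majda–Bertozzi 2002, Thm. 3.4: `T = T(‖v₀‖_{H^m})`; Cheskidov–Luo 2022, §3.1:
"for all sufficiently small `τ`"; adapted from `CorrectorFourier.exists_threshold`). [folklore] -/
theorem exists_threshold {ν Z ρ A : ℝ} (hρ : 0 < ρ) (hZ : 0 ≤ Z) (hA : 0 ≤ A) :
    ∃ θ₀ : ℝ, 0 < θ₀ ∧ θ₀ ≤ 1 ∧ ∀ θ : ℝ, 0 < θ → θ ≤ θ₀ →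
      gainConst ν * Real.sqrt θ * ballConst d Z ρ A ≤ ρ / 2 ∧
      gainConst ν * Real.sqrt θ * lipConst d Z ρ A ≤ 1 / 2 := by
  set E : ℝ := gainConst ν with hE
  set Cb : ℝ := ballConst d Z ρ A with hCb
  set L : ℝ := lipConst d Z ρ A with hL
  have hE0 : 0 ≤ E := (gainConst_pos ν).le
  have hCb0 : 0 ≤ Cb := ballConst_nonneg hZ hρ.le hA
  have hL0 : 0 ≤ L := lipConst_nonneg hZ hρ.le hA
  set M : ℝ := max (2 * E * Cb / ρ) (2 * E * L) with hM
  have hM0 : 0 ≤ M := le_max_of_le_right (by positivity)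
  have hM1 : 0 < M + 1 := by linarith
  refine ⟨min 1 ((1 / (M + 1)) ^ 2), lt_min one_pos (by positivity), min_le_left _ _, ?_⟩
  intro θ hθ hθle
  have hsq : Real.sqrt θ ≤ 1 / (M + 1) := by
    rw [Real.sqrt_le_left (by positivity)]
    exact hθle.trans (min_le_right _ _)
  have h1 : E * Real.sqrt θ * Cb ≤ E * Cb / (M + 1) := by
    calc E * Real.sqrt θ * Cb = E * Cb * Real.sqrt θ := by ring
      _ ≤ E * Cb * (1 / (M + 1)) := mul_le_mul_of_nonneg_left hsq (by positivity)
      _ = E * Cb / (M + 1) := by ring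
  have h2 : E * Real.sqrt θ * L ≤ E * L / (M + 1) := by
    calc E * Real.sqrt θ * L = E * L * Real.sqrt θ := by ring
      _ ≤ E * L * (1 / (M + 1)) := mul_le_mul_of_nonneg_left hsq (by positivity)
      _ = E * L / (M + 1) := by ring
  constructor
  · refine h1.trans ?_
    rw [div_le_iff₀ hM1]
    have : 2 * E * Cb / ρ ≤ M := le_max_left _ _
    rw [div_le_iff₀ hρ] at this
    nlinarith
  · refine h2.trans ?_
    rw [div_le_iff₀ hM1]
    have : 2 * E * L ≤ M := le_max_right _ _
    nlinarith

end Threshold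

end PerturbedNSFourier

end Literature.Analysis.FluidPDE

end
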